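import Mathlib.MeasureTheory.Measure.Lebesgue.Basic
import Literature.Analysis.Fourier.FractalUncertaintyPrinciple
import HarnessLib

/-!
# The missing subinterval property of `δ`-regular sets, `δ < 1` (Bourgain–Dyatlov 2018, §2.2)

Topic `Literature/Analysis/Fourier`; companion to `FractalUncertaintyPrinciple.lean`
(`IsRegularSet` = BD18 Definition 1.1). J. Bourgain, S. Dyatlov, *Spectral gaps without the
pressure condition*, Ann. of Math. 187 (2018), §2.2, Lemma "The missing subinterval property":
a `δ`-regular set with `δ < 1` misses one of any `L ≥ (3C_R)^{2/(1-δ)}` consecutive cells of an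
admissible size — the quantitative nowhere-density that drives the induction on scales in the
proof of the fractal uncertainty principle (BD18 Theorem 4, `bourgainDyatlov2018_thm4`), through
the "each parent is missing a child" property of the covering tree.

* `IsRegularSet.exists_missing_cell` — the lemma as printed (cells `[a + ℓw, a + (ℓ+1)w]`,
  `ℓ < L`, of a window `[a, a + Lw]` with `α₀ ≤ w`, `Lw ≤ α₁`).

Deliberately NOT here: the covering tree `V_n(X)` and the missing-child corollary (BD18 §2.2,
end), which belong with the iteration argument of §3.4.
-/

namespace Literature.Analysis.Fourier

open _root_.MeasureTheory Set
open scoped ENNReal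

variable {X : Set ℝ} {δ C_R α₀ α₁ : ℝ}

/-- **The missing subinterval property** (BD18 §2.2): let `X` be `δ`-regular with constant
`C_R ≥ 1` on scales `α₀` to `α₁`, `0 ≤ δ < 1`, and let `L` be an integer with
`L ≥ (3 C_R)^{2/(1-δ)}`. If `[a, a + Lw]` is an interval with `α₀ ≤ w` and `Lw ≤ α₁`, partitioned
into the `L` cells `[a + ℓw, a + (ℓ+1)w]`, then some cell does not meet `X` (a quantitative form of
"`δ`-regular sets with `δ < 1` are nowhere dense"). Proof as printed: otherwise each fattened cell
`[a + (ℓ - 1/2)w, a + (ℓ + 3/2)w]` has mass `≥ C_R⁻¹ w^δ`, cells with `ℓ` in a fixed residue mod 3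
are disjoint and all lie in a set of mass `≤ 2 C_R (Lw)^δ`, whence `L^{1-δ} ≤ 6 C_R² < 9 C_R²`.
[cite: BourgainDyatlov2018, §2.2, Lemma "The missing subinterval property"] -/
theorem IsRegularSet.exists_missing_cell (h : IsRegularSet X δ C_R α₀ α₁) (hδ : 0 ≤ δ) (hδ1 : δ < 1)
    (hC : 1 ≤ C_R) {L : ℕ} (hL : (3 * C_R) ^ (2 / (1 - δ)) ≤ (L : ℝ)) {a w : ℝ} (hw0 : 0 < w)
    (hw : α₀ ≤ w) (hLw : L * w ≤ α₁) :
    ∃ ℓ : ℕ, ℓ < L ∧ X ∩ Icc (a + ℓ * w) (a + (ℓ + 1) * w) = ∅ := by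
  classical
  obtain ⟨-, -, μ, -, hμ⟩ := h
  have hC0 : 0 < C_R := by linarith
  -- `L ≥ 9 C_R² ≥ 9`
  have hL9 : 9 * C_R ^ 2 ≤ (L : ℝ) := by
    have h1 : (3 * C_R) ^ (2 : ℝ) ≤ (3 * C_R) ^ (2 / (1 - δ)) := by
      apply Real.rpow_le_rpow_of_exponent_le (by linarith)
      rw [le_div_iff₀ (by linarith)]
      nlinarith
    rw [Real.rpow_two] at h1
    nlinarith
  have hL1 : (1 : ℝ) ≤ L := by nlinarith
  have hLpos : (0 : ℝ) < L := by linarith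
  by_contra hcon
  push Not at hcon
  set J' : ℕ → Set ℝ := fun ℓ => Icc (a + ℓ * w - w / 2) (a + ℓ * w + 3 * w / 2) with hJ'def
  -- each fattened cell has mass ≥ C_R⁻¹ w^δ
  have hlow : ∀ ℓ ∈ Finset.range L, ENNReal.ofReal (C_R⁻¹ * w ^ δ) ≤ μ (J' ℓ) := by
    intro ℓ hℓ
    obtain ⟨x, hxX, hxJ⟩ := hcon ℓ (Finset.mem_range.1 hℓ)
    simp only [mem_Icc] at hxJ
    have hint := (hμ (x - w / 2) (x + w / 2) (by linarith) (by linarith) (by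
      have : x + w / 2 - (x - w / 2) = w := by ring
      rw [this]; nlinarith)).2 (by
        have : (x - w / 2 + (x + w / 2)) / 2 = x := by ring
        rw [this]; exact hxX)
    have hlen : x + w / 2 - (x - w / 2) = w := by ring
    rw [hlen] at hint
    refine hint.trans (measure_mono ?_)
    simp only [hJ'def]
    apply Icc_subset_Icc <;> linarith
  -- the fattened cells lie in a set of mass ≤ 2 C_R (Lw)^δ
  have hmass : μ (Icc (a - w / 2) (a + L * w + w / 2)) ≤ ENNReal.ofReal (2 * C_R * (L * w) ^ δ) := by
    have hLw0 : α₀ ≤ L * w := hw.trans (by nlinarith)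
    have h1 := (hμ (a - w / 2) (a - w / 2 + L * w) (by nlinarith) (by ring_nf; linarith)
      (by ring_nf; linarith)).1
    have h2 := (hμ (a + w / 2) (a + w / 2 + L * w) (by nlinarith) (by ring_nf; linarith)
      (by ring_nf; linarith)).1
    have e1 : a - w / 2 + L * w - (a - w / 2) = L * w := by ring
    have e2 : a + w / 2 + L * w - (a + w / 2) = L * w := by ring
    rw [e1] at h1
    rw [e2] at h2
    have hsub : Icc (a - w / 2) (a + L * w + w / 2) ⊆
        Icc (a - w / 2) (a - w / 2 + L * w) ∪ Icc (a + w / 2) (a + w / 2 + L * w) := by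
      intro y hy
      simp only [mem_Icc, mem_union] at hy ⊢
      rcases le_or_gt y (a - w / 2 + L * w) with h | h
      · exact Or.inl ⟨hy.1, h⟩
      · right; constructor <;> nlinarith
    have hnn : 0 ≤ C_R * (L * w) ^ δ := by positivity
    calc μ (Icc (a - w / 2) (a + L * w + w / 2))
        ≤ μ (Icc (a - w / 2) (a - w / 2 + L * w)) + μ (Icc (a + w / 2) (a + w / 2 + L * w)) :=
          (measure_mono hsub).trans (measure_union_le _ _)
      _ ≤ ENNReal.ofReal (C_R * (L * w) ^ δ) + ENNReal.ofReal (C_R * (L * w) ^ δ) := by gcongr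
      _ = ENNReal.ofReal (2 * C_R * (L * w) ^ δ) := by
          rw [← ENNReal.ofReal_add hnn hnn]; congr 1; ring
  -- disjointness within a residue mod 3
  have hdisj : ∀ r : ℕ,
      (↑((Finset.range L).filter fun ℓ => ℓ % 3 = r) : Set ℕ).PairwiseDisjoint J' := by
    intro r ℓ hℓ ℓ' hℓ' hne
    have h3 : ℓ % 3 = r := (Finset.mem_filter.1 hℓ).2
    have h3' : ℓ' % 3 = r := (Finset.mem_filter.1 hℓ').2
    change Disjoint (J' ℓ) (J' ℓ')
    rw [Set.disjoint_left]
    intro y hy hy'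
    simp only [hJ'def, mem_Icc] at hy hy'
    rcases lt_or_gt_of_ne hne with hlt | hlt
    · have : ℓ + 3 ≤ ℓ' := by omega
      have hR : (ℓ : ℝ) + 3 ≤ ℓ' := by exact_mod_cast this
      nlinarith
    · have : ℓ' + 3 ≤ ℓ := by omega
      have hR : (ℓ' : ℝ) + 3 ≤ ℓ := by exact_mod_cast this
      nlinarith
  -- counting within a residue
  have hcardr : ∀ r : ℕ,
      ((((Finset.range L).filter fun ℓ => ℓ % 3 = r).card : ℝ)) ≤ 2 * C_R ^ 2 * (L : ℝ) ^ δ := by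
    intro r
    set Sr := (Finset.range L).filter fun ℓ => ℓ % 3 = r with hSr
    have hE : (Sr.card : ℝ≥0∞) * ENNReal.ofReal (C_R⁻¹ * w ^ δ)
        ≤ ENNReal.ofReal (2 * C_R * (L * w) ^ δ) := by
      calc (Sr.card : ℝ≥0∞) * ENNReal.ofReal (C_R⁻¹ * w ^ δ)
            = ∑ ℓ ∈ Sr, ENNReal.ofReal (C_R⁻¹ * w ^ δ) := by
              rw [Finset.sum_const, nsmul_eq_mul]
        _ ≤ ∑ ℓ ∈ Sr, μ (J' ℓ) :=
              Finset.sum_le_sum fun ℓ hℓ => hlow ℓ (Finset.mem_filter.1 hℓ).1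
        _ = μ (⋃ ℓ ∈ Sr, J' ℓ) :=
              (measure_biUnion_finset (hdisj r) fun _ _ => measurableSet_Icc).symm
        _ ≤ μ (Icc (a - w / 2) (a + L * w + w / 2)) := by
              apply measure_mono
              intro y hy
              obtain ⟨ℓ, hℓ, hy⟩ := Set.mem_iUnion₂.1 hy
              have hℓL : ℓ < L := Finset.mem_range.1 (Finset.mem_filter.1 hℓ).1
              have hℓL' : (ℓ : ℝ) + 1 ≤ L := by exact_mod_cast hℓL
              simp only [hJ'def, mem_Icc] at hy ⊢
              have h0 : (0 : ℝ) ≤ ℓ := Nat.cast_nonneg ℓ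
              constructor <;> nlinarith
        _ ≤ ENNReal.ofReal (2 * C_R * (L * w) ^ δ) := hmass
    have hE' : (Sr.card : ℝ) * (C_R⁻¹ * w ^ δ) ≤ 2 * C_R * (L * w) ^ δ := by
      rw [← ENNReal.ofReal_natCast, ← ENNReal.ofReal_mul (by positivity),
        ENNReal.ofReal_le_ofReal_iff (by positivity)] at hE
      exact hE
    rw [Real.mul_rpow hLpos.le hw0.le] at hE'
    have hwδ : 0 < w ^ δ := Real.rpow_pos_of_pos hw0 δ
    have key : (Sr.card : ℝ) * w ^ δ ≤ (2 * C_R ^ 2 * (L : ℝ) ^ δ) * w ^ δ := by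
      have : (Sr.card : ℝ) * w ^ δ = C_R * ((Sr.card : ℝ) * (C_R⁻¹ * w ^ δ)) := by field_simp
      rw [this]
      calc C_R * ((Sr.card : ℝ) * (C_R⁻¹ * w ^ δ)) ≤ C_R * (2 * C_R * ((L : ℝ) ^ δ * w ^ δ)) := by
            gcongr
        _ = (2 * C_R ^ 2 * (L : ℝ) ^ δ) * w ^ δ := by ring
    exact le_of_mul_le_mul_right key hwδ
  -- summing over the three residues: L ≤ 6 C_R² L^δ
  have hcard : (L : ℝ) ≤ 6 * C_R ^ 2 * (L : ℝ) ^ δ := by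
    have hmaps : (↑(Finset.range L) : Set ℕ).MapsTo (fun ℓ : ℕ => ℓ % 3)
        (↑({0, 1, 2} : Finset ℕ)) := by
      intro ℓ _
      have h1 : ℓ % 3 < 3 := Nat.mod_lt ℓ (by norm_num)
      simp only [Finset.coe_insert, Finset.coe_singleton, Set.mem_insert_iff,
        Set.mem_singleton_iff]
      omega
    have := Finset.card_eq_sum_card_fiberwise hmaps
    rw [Finset.card_range] at this
    have hLeq : (L : ℝ) = ((∑ b ∈ ({0, 1, 2} : Finset ℕ),
        ((Finset.range L).filter fun ℓ => ℓ % 3 = b).card : ℕ) : ℝ) := by exact_mod_cast this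
    have h0 := hcardr 0
    have h1 := hcardr 1
    have h2 := hcardr 2
    calc (L : ℝ) = ((∑ b ∈ ({0, 1, 2} : Finset ℕ),
          ((Finset.range L).filter fun ℓ => ℓ % 3 = b).card : ℕ) : ℝ) := hLeq
      _ = (((Finset.range L).filter fun ℓ => ℓ % 3 = 0).card : ℝ)
          + (((Finset.range L).filter fun ℓ => ℓ % 3 = 1).card : ℝ)
          + (((Finset.range L).filter fun ℓ => ℓ % 3 = 2).card : ℝ) := by
          rw [Finset.sum_insert (by decide), Finset.sum_insert (by decide), Finset.sum_singleton]
          push_cast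
          ring
      _ ≤ 6 * C_R ^ 2 * (L : ℝ) ^ δ := by linarith
  -- contradiction with `L ≥ (3 C_R)^{2/(1-δ)}`, i.e. `L^{1-δ} ≥ 9 C_R²`
  have hLδ : 0 < (L : ℝ) ^ δ := Real.rpow_pos_of_pos hLpos δ
  have h1δ : 0 < 1 - δ := by linarith
  have hup : (L : ℝ) ^ (1 - δ) ≤ 6 * C_R ^ 2 := by
    rw [Real.rpow_sub hLpos, Real.rpow_one, div_le_iff₀ hLδ]
    exact hcard
  have hdown : 9 * C_R ^ 2 ≤ (L : ℝ) ^ (1 - δ) := by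
    have := Real.rpow_le_rpow (by positivity) hL h1δ.le
    rw [← Real.rpow_mul (by linarith), div_mul_cancel₀ _ h1δ.ne', Real.rpow_two] at this
    nlinarith
  nlinarith


end Literature.Analysis.Fourier
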